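import Mathlib
import HarnessLib
import Literature.Analysis.FluidPDE.SuitableWeak
import Literature.Analysis.FluidPDE.SelfSimilar
import Literature.Analysis.FluidPDE.LocalTypeI
import Literature.Analysis.FluidPDE.OseenMildUniqueness
import Literature.Analysis.FluidPDE.NSBoundedMildAnalytic

/-!
# Analytic spread: band slices constant on a ball vanish (line dissipation-quantum-tolerance,
# crux ApexLocalisation, stub `stub_analyticSpread`)

`stub_analyticSpread`: a field `v : ℝ → ℝ³ → ℝ³`, continuous on the open backward slab
`(-∞, 0) × ℝ³`, with the Type-I rate `‖v(t, x)‖ ≤ C/√(−t)`, solving the Oseen integral equation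
`v(t) = e^{(t−s)Δ} v(s) − B¹ₛ(v, v)(t)` pointwise for all `s < t < 0`, with the Morrey bound
`∫_{B_m(0)} ‖v(t)‖² ≤ I m` for a.e. `t ∈ (−m², 0)` and every `m ≥ 1`, and whose slices are
constant on `B_{1/2}(0)` for `t ∈ (−1/2, −1/4)`, vanishes on `(−1/2, −1/4) × ℝ³`.

Proof.
1. `analyticOnNhd_slice_of_oseenMild`: every slice `v(t₀)`, `t₀ < 0`, is real-analytic on `ℝ³`.
   Restart at `s = t₀ − L/2` from the bounded continuous datum `v(s)` (`‖v‖ ≤ C/√(−t₀/2) < M₀` on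
   `(−∞, t₀/2)`): the local analyticity of Oseen's scheme (Lemarié-Rieusset 2016, Thm. 9.12 =
   tree `lemarieRieusset2016_local_analyticity_holds`, window `L = ε/M₀²`) gives a jointly
   real-analytic solution `w` of the same integral equation on `(s, s + L) × ℝ³`, bounded by
   `C_A M₀`; bounded solutions are unique (KNSS 2009 §4 = tree `oseenMild_bounded_unique`, on
   `(s, min(s + L, t₀/2))`), so `v(t₀) = w(t₀)` a.e., hence everywhere (continuous slices), and
   the slices of `w` are analytic (`analyticOnNhd_slice`).
2. `eq_apply_zero_of_analyticOnNhd_of_ball`: identity theorem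
   (`AnalyticOnNhd.eqOn_zero_of_preconnected_of_eventuallyEq_zero` on the preconnected `univ`):
   an analytic slice constant on `B_{1/2}(0)` is constant on `ℝ³`.
3. `eq_zero_of_enorm_sq_mul_volume_ball_le`: a constant `c` with `‖c‖² vol(B_{n+1}) ≤ I (n+1)` for
   all `n : ℕ` vanishes (`vol(B_{n+1}) = (n+1)³ vol(B₁)`); by the Morrey bound at the countably
   many radii `m = n + 1` this holds at a.e. band time, so `v(t, ·) = 0` for a.e.
   `t ∈ (−1/2, −1/4)`.
4. For fixed `x`, `t ↦ v(t, x)` is continuous on the band and vanishes a.e., hence everywhere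
   (`Measure.eqOn_open_of_ae_eq`).

## References

* P. G. Lemarié-Rieusset, *The Navier–Stokes Problem in the 21st Century*, CRC Press (2016),
  doi:10.1201/b19556, Thm. 9.12 (PDF p. 260; proof pp. 260–263). [LemarieRieusset2016]
* G. Koch, N. Nadirashvili, G. Seregin, V. Šverák, *Liouville theorems for the Navier–Stokes
  equations and applications*, Acta Math. 203 (2009) = arXiv:0709.3599, §4 (4.3)–(4.4).
  [KochNadirashviliSereginSverak2009]
-/

set_option linter.dupNamespace false

namespace Summit.NavierStokesRegularity.NavierStokesRegularity.Theorems.RellichScarApexLocalisation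

open MeasureTheory Set Function Metric Filter Topology TopologicalSpace
open scoped ENNReal NNReal
open Literature.Analysis Literature.Analysis.FluidPDE

local notation "E³" => EuclideanSpace ℝ (Fin 3)

/-! ### Tool 1: slices of a continuous Oseen-mild rate field are real-analytic -/

/-- **Slices of a continuous Oseen-mild Type-I-rate field are real-analytic in space**
(Lemarié-Rieusset 2016, Thm. 9.12: bounded mild solutions are space–time analytic; tree
`lemarieRieusset2016_local_analyticity_holds`, identified with the given field by the uniqueness
of bounded Oseen-mild solutions `oseenMild_bounded_unique`). If `v` is continuous on the open slab
`(-∞, 0) × ℝ³` with the rate `‖v(t, x)‖ ≤ C/√(−t)` and solves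
`v(t) = e^{(t−s)Δ} v(s) − B¹ₛ(v, v)(t)` pointwise for all `s < t < 0`, then `v(t₀, ·)` is
real-analytic on `ℝ³` for every `t₀ < 0`.
[cite: LemarieRieusset2016, Thm. 9.12 (PDF p. 260; proof pp. 260–263)] -/
theorem analyticOnNhd_slice_of_oseenMild {v : ℝ → E³ → E³} {C t₀ : ℝ} (ht₀ : t₀ < 0)
    (hvcont : ContinuousOn (uncurry v) (Iio (0 : ℝ) ×ˢ univ)) (hvC : HasTypeITimeDecay C v)
    (hmild : ∀ s t : ℝ, s < t → t < 0 → ∀ x : E³,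
      v t x = UnboundedOperators.heatExtension (v s) (t - s) x - oseenDuhamel 1 s v v t x) :
    AnalyticOnNhd ℝ (v t₀) univ := by
  -- `0 ≤ C` (the rate at `(t₀, 0)`)
  have hC0 : 0 ≤ C := by
    have ha : 0 < Real.sqrt (-t₀) := Real.sqrt_pos.2 (neg_pos.2 ht₀)
    have h1 : 0 ≤ C / Real.sqrt (-t₀) := (norm_nonneg _).trans (hvC t₀ ht₀ 0)
    have h2 := (le_div_iff₀ ha).1 h1
    simpa using h2
  -- the uniform bound `M₀` below the time `t₀ / 2`
  have hT0 : t₀ / 2 < 0 := by linarith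
  have hsq : 0 < Real.sqrt (-(t₀ / 2)) := Real.sqrt_pos.2 (neg_pos.2 hT0)
  set M₀ : ℝ := C / Real.sqrt (-(t₀ / 2)) + 1 with hM₀
  have hM₀0 : 0 < M₀ := by
    have : 0 ≤ C / Real.sqrt (-(t₀ / 2)) := div_nonneg hC0 (Real.sqrt_nonneg _)
    linarith
  have hrate : ∀ τ < t₀ / 2, ∀ y, ‖v τ y‖ ≤ M₀ := fun τ hτ y => by
    refine (hvC τ (hτ.trans hT0) y).trans ?_
    refine (div_le_div_of_nonneg_left hC0 hsq (Real.sqrt_le_sqrt (by linarith))).trans ?_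
    linarith
  -- the local analytic solution from the datum `v s`, `s = t₀ - L / 2`
  obtain ⟨ε, hε, C_A, -, hloc⟩ := lemarieRieusset2016_local_analyticity_holds
  set L : ℝ := ε * 1 / M₀ ^ 2 with hL
  have hL0 : 0 < L := by positivity
  set s : ℝ := t₀ - L / 2 with hs
  have hst₀ : s < t₀ := by linarith
  have ht₀L : t₀ < s + L := by linarith
  have hs2 : s < t₀ / 2 := by linarith
  have hs0 : s < 0 := hst₀.trans ht₀
  have hcs : Continuous (v s) :=
    hvcont.comp_continuous (Continuous.prodMk_right s) fun _ => ⟨hs0, mem_univ _⟩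
  have ha_bd : eLpNorm (v s) ∞ volume ≤ ENNReal.ofReal M₀ := by
    rw [eLpNorm_exponent_top]
    exact eLpNormEssSup_le_of_ae_bound (Eventually.of_forall fun y => hrate s hs2 y)
  obtain ⟨w, hw_an, hw_eq, hw_bd⟩ := hloc one_pos s hM₀0 hcs.aestronglyMeasurable ha_bd
  -- uniqueness of bounded solutions on `(s, T)`, `T = min (s + L) (t₀ / 2)`
  set T : ℝ := min (s + L) (t₀ / 2) with hT
  have hTL : T ≤ s + L := min_le_left _ _
  have hT2 : T ≤ t₀ / 2 := min_le_right _ _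
  have ht₀T : t₀ < T := lt_min ht₀L (by linarith)
  set M' : ℝ := max M₀ (C_A * M₀) with hM'
  have hM'0 : 0 ≤ M' := hM₀0.le.trans (le_max_left _ _)
  have hsub : Ioo s T ×ˢ (univ : Set E³) ⊆ Iio (0 : ℝ) ×ˢ univ :=
    prod_mono (fun τ hτ => (hτ.2.trans_le hT2).trans hT0) Subset.rfl
  have hum : AEStronglyMeasurable (uncurry v)
      ((volume : Measure (ℝ × E³)).restrict (Ioo s T ×ˢ univ)) :=
    (hvcont.mono hsub).aestronglyMeasurable (measurableSet_Ioo.prod MeasurableSet.univ)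
  have hwm : AEStronglyMeasurable (uncurry w)
      ((volume : Measure (ℝ × E³)).restrict (Ioo s T ×ˢ univ)) :=
    (hw_an.continuousOn.mono (prod_mono (Ioo_subset_Ioo_right hTL) Subset.rfl)).aestronglyMeasurable
      (measurableSet_Ioo.prod MeasurableSet.univ)
  have huM : ∀ τ ∈ Ioo s T, ∀ y, ‖v τ y‖ ≤ M' := fun τ hτ y =>
    (hrate τ (hτ.2.trans_le hT2) y).trans (le_max_left _ _)
  have hwM : ∀ τ ∈ Ioo s T, ∀ y, ‖w τ y‖ ≤ M' := fun τ hτ y =>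
    (hw_bd τ ⟨hτ.1, hτ.2.trans_le hTL⟩ y).trans (le_max_right _ _)
  have hu : ∀ τ ∈ Ioo s T, v τ =ᵐ[volume] fun x =>
      UnboundedOperators.heatExtension (v s) (τ - s) x - oseenDuhamel 1 s v v τ x :=
    fun τ hτ => Eventually.of_forall fun x => hmild s τ hτ.1 ((hτ.2.trans_le hT2).trans hT0) x
  have hw : ∀ τ ∈ Ioo s T, w τ =ᵐ[volume] fun x =>
      UnboundedOperators.heatExtension (v s) (τ - s) x - oseenDuhamel 1 s w w τ x :=
    fun τ hτ => Eventually.of_forall fun x => by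
      have h := hw_eq τ ⟨hτ.1, hτ.2.trans_le hTL⟩ x
      rwa [one_mul] at h
  have huniq := oseenMild_bounded_unique
    (U := fun τ x => UnboundedOperators.heatExtension (v s) (τ - s) x)
    one_pos hM'0 hum hwm huM hwM hu hw t₀ ⟨hst₀, ht₀T⟩
  -- `v t₀ = w t₀` a.e., hence everywhere (continuous slices); the slice `w t₀` is analytic
  have hct : Continuous (v t₀) :=
    hvcont.comp_continuous (Continuous.prodMk_right t₀) fun _ => ⟨ht₀, mem_univ _⟩
  have hwan : AnalyticOnNhd ℝ (w t₀) univ := analyticOnNhd_slice hw_an ⟨hst₀, ht₀L⟩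
  have heq : v t₀ = w t₀ := Measure.eq_of_ae_eq huniq hct hwan.continuous
  rw [heq]
  exact hwan

/-! ### Tool 2: identity theorem — analytic and constant on a ball ⇒ constant -/

/-- **A real-analytic field on `ℝ³` which is constant on a ball `B_r(0)` is constant** (identity
theorem for real-analytic maps on the preconnected `ℝ³`, applied to `f − f(0)`). -/
theorem eq_apply_zero_of_analyticOnNhd_of_ball {f : E³ → E³} (hf : AnalyticOnNhd ℝ f univ)
    {r : ℝ} (hr : 0 < r) (h : ∀ x ∈ ball (0 : E³) r, ∀ y ∈ ball (0 : E³) r, f x = f y)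
    (x : E³) : f x = f 0 := by
  have hg : AnalyticOnNhd ℝ (fun y => f y - f 0) univ := hf.sub analyticOnNhd_const
  have hev : (fun y => f y - f 0) =ᶠ[𝓝 (0 : E³)] 0 :=
    Filter.eventually_of_mem (isOpen_ball.mem_nhds (mem_ball_self hr)) fun y hy =>
      sub_eq_zero.2 (h y hy 0 (mem_ball_self hr))
  exact sub_eq_zero.1 (hg.eqOn_zero_of_preconnected_of_eventuallyEq_zero isPreconnected_univ
    (mem_univ 0) hev (mem_univ x))

/-! ### Tool 3: the Morrey bound kills constants -/

/-- **The Morrey bound kills constants**: if `‖c‖² · vol(B_{n+1}(0)) ≤ I (n+1)` for every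
`n : ℕ`, then `c = 0` — `vol(B_{n+1}(0)) = (n+1)³ vol(B₁(0))` and `(n+1)² ‖c‖² vol(B₁(0))`
exceeds `I` for `n` large unless `c = 0`. -/
theorem eq_zero_of_enorm_sq_mul_volume_ball_le {c : E³} {I : ℝ}
    (h : ∀ n : ℕ, ‖c‖ₑ ^ 2 * volume (ball (0 : E³) ((n : ℝ) + 1)) ≤
      ENNReal.ofReal (I * ((n : ℝ) + 1))) :
    c = 0 := by
  by_contra hc
  have hcpos : 0 < ‖c‖ ^ 2 := pow_pos (norm_pos_iff.2 hc) 2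
  have hV0 : volume (ball (0 : E³) 1) ≠ 0 := (measure_ball_pos volume (0 : E³) one_pos).ne'
  have hVtop : volume (ball (0 : E³) 1) ≠ ⊤ := measure_ball_lt_top.ne
  obtain ⟨V, hV, hVeq⟩ : ∃ V : ℝ, 0 < V ∧ volume (ball (0 : E³) 1) = ENNReal.ofReal V :=
    ⟨_, ENNReal.toReal_pos hV0 hVtop, (ENNReal.ofReal_toReal hVtop).symm⟩
  have hK0 : 0 < ‖c‖ ^ 2 * V := mul_pos hcpos hV
  obtain ⟨n, hn⟩ := exists_nat_gt (|I| / (‖c‖ ^ 2 * V))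
  have hn' : |I| < (n : ℝ) * (‖c‖ ^ 2 * V) := (div_lt_iff₀ hK0).1 hn
  set m : ℝ := (n : ℝ) + 1 with hm
  have hm1 : 1 ≤ m := by
    have : (0 : ℝ) ≤ n := n.cast_nonneg
    linarith
  have hm0 : 0 < m := by linarith
  -- the volume of `B_m(0)` and the left-hand side as `ofReal`
  have hvol : volume (ball (0 : E³) m) = ENNReal.ofReal (m ^ 3) * volume (ball (0 : E³) 1) := by
    rw [Measure.addHaar_ball_of_pos volume (0 : E³) hm0, finrank_euclideanSpace_fin]
  have hlhs : ENNReal.ofReal (‖c‖ ^ 2 * (m ^ 3 * V)) = ‖c‖ₑ ^ 2 * volume (ball (0 : E³) m) := by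
    rw [ENNReal.ofReal_mul hcpos.le, ENNReal.ofReal_mul (pow_pos hm0 3).le,
      ENNReal.ofReal_pow (norm_nonneg _), ofReal_norm, ← hVeq, hvol]
  -- `I m < ‖c‖² m³ V`
  have hreal : I * m < ‖c‖ ^ 2 * (m ^ 3 * V) := by
    have h1 : I * m ≤ |I| * m := mul_le_mul_of_nonneg_right (le_abs_self I) hm0.le
    have h2 : |I| < m * (‖c‖ ^ 2 * V) := by nlinarith
    have h3 : |I| * m < m * (‖c‖ ^ 2 * V) * m := mul_lt_mul_of_pos_right h2 hm0
    have h4 : m * (‖c‖ ^ 2 * V) * m ≤ ‖c‖ ^ 2 * (m ^ 3 * V) := by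
      have h5 : m ^ 2 ≤ m ^ 3 := pow_le_pow_right₀ hm1 (by norm_num)
      nlinarith
    linarith
  have hlt : ENNReal.ofReal (I * m) < ‖c‖ₑ ^ 2 * volume (ball (0 : E³) m) := by
    rw [← hlhs]
    exact ENNReal.ofReal_lt_ofReal_iff'.2 ⟨hreal, by positivity⟩
  exact absurd (h n) (not_le.2 hlt)

/-! ### The stub -/

/-- **S2, ANALYTIC SPREAD** (Lemarié-Rieusset 2016 Thm 9.12 = tree
`lemarieRieusset2016_local_analyticity_holds`: bounded Oseen-mild fields are real-analytic in space,
identified with `v` by `oseenMild_bounded_unique`; identity theorem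
`AnalyticOnNhd.eqOn_zero_of_preconnected_of_eventuallyEq_zero`; the Morrey bound
`∫_{B_m} ‖v(t)‖² ≤ I m` forces a spatially constant slice to vanish): a continuous Oseen-mild field on
the open slab with the rate `C/√(−t)` and the Morrey bound, whose slices are constant on `B_{1/2}(0)`
for `t ∈ (−1/2,−1/4)`, vanishes on `(−1/2,−1/4) × ℝ³`.
[cite: LemarieRieusset2016, Thm. 9.12 (PDF p. 260; proof pp. 260–263)] -/
theorem stub_analyticSpread :
    ∀ (v : ℝ → E³ → E³) (C I : ℝ), ContinuousOn (uncurry v) (Iio (0 : ℝ) ×ˢ univ) →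
      HasTypeITimeDecay C v →
      (∀ s t : ℝ, s < t → t < 0 → ∀ x : E³,
        v t x = UnboundedOperators.heatExtension (v s) (t - s) x - oseenDuhamel 1 s v v t x) →
      (∀ m : ℝ, 1 ≤ m → ∀ᵐ t ∂(volume.restrict (Ioo (-m ^ 2) (0 : ℝ))),
        ∫⁻ y in ball (0 : E³) m, ‖v t y‖ₑ ^ 2 ≤ ENNReal.ofReal (I * m)) →
      (∀ t ∈ Ioo (-(1 / 2) : ℝ) (-(1 / 4)), ∀ x ∈ ball (0 : E³) (1 / 2), ∀ y ∈ ball (0 : E³) (1 / 2),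
        v t x = v t y) →
      ∀ t ∈ Ioo (-(1 / 2) : ℝ) (-(1 / 4)), ∀ x : E³, v t x = 0 := by
  intro v C I hvcont hvC hmild hMorrey hconst
  -- (1)–(2): every band slice is constant on `ℝ³`
  have hcst : ∀ t ∈ Ioo (-(1 / 2) : ℝ) (-(1 / 4)), ∀ x : E³, v t x = v t 0 := fun t ht x =>
    eq_apply_zero_of_analyticOnNhd_of_ball
      (analyticOnNhd_slice_of_oseenMild (by linarith [ht.2]) hvcont hvC hmild)
      (by norm_num : (0 : ℝ) < 1 / 2) (hconst t ht) x
  -- (3): the Morrey bound at the radii `m = n + 1`, transported to the band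
  have hband : ∀ n : ℕ, ∀ᵐ t ∂(volume.restrict (Ioo (-(1 / 2) : ℝ) (-(1 / 4)))),
      ∫⁻ y in ball (0 : E³) ((n : ℝ) + 1), ‖v t y‖ₑ ^ 2 ≤
        ENNReal.ofReal (I * ((n : ℝ) + 1)) := by
    intro n
    have hn0 : (0 : ℝ) ≤ n := n.cast_nonneg
    have hn1 : (1 : ℝ) ≤ (n : ℝ) + 1 := by linarith
    have hsub : Ioo (-(1 / 2) : ℝ) (-(1 / 4)) ⊆ Ioo (-((n : ℝ) + 1) ^ 2) 0 := fun t ht =>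
      ⟨by nlinarith [ht.1], by linarith [ht.2]⟩
    exact ae_restrict_of_ae_restrict_of_subset hsub (hMorrey _ hn1)
  have hae : ∀ᵐ t ∂(volume.restrict (Ioo (-(1 / 2) : ℝ) (-(1 / 4)))), ∀ x : E³, v t x = 0 := by
    filter_upwards [ae_all_iff.2 hband, ae_restrict_mem measurableSet_Ioo] with t ht htmem
    have hint : ∀ m : ℝ, ∫⁻ y in ball (0 : E³) m, ‖v t y‖ₑ ^ 2 =
        ‖v t 0‖ₑ ^ 2 * volume (ball (0 : E³) m) := fun m => by
      rw [← setLIntegral_const]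
      exact lintegral_congr fun y => by rw [hcst t htmem y]
    have hc : v t 0 = 0 := by
      refine eq_zero_of_enorm_sq_mul_volume_ball_le (I := I) fun n => ?_
      rw [← hint]
      exact ht n
    intro x
    rw [hcst t htmem x, hc]
  -- (4): continuity in time upgrades "a.e. band time" to "every band time"
  intro t ht x
  have hcx : ContinuousOn (fun τ => v τ x) (Ioo (-(1 / 2) : ℝ) (-(1 / 4))) :=
    hvcont.comp (Continuous.prodMk_left x).continuousOn fun τ hτ =>
      ⟨lt_trans hτ.2 (by norm_num), mem_univ _⟩
  have hae' : (fun τ => v τ x) =ᵐ[volume.restrict (Ioo (-(1 / 2) : ℝ) (-(1 / 4)))]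
      fun _ => (0 : E³) :=
    hae.mono fun τ hτ => hτ x
  exact Measure.eqOn_open_of_ae_eq hae' isOpen_Ioo hcx continuousOn_const ht

end Summit.NavierStokesRegularity.NavierStokesRegularity.Theorems.RellichScarApexLocalisation
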